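import Summits.AtomisticToContinuum.HydrodynamicLimit.Theorems.CollisionIsometryCLTAdaptedWeightCLTBHEEPClosureFlux
import Summits.AtomisticToContinuum.HydrodynamicLimit.Theorems.CollisionIsometryCLTAdaptedWeightCLTBHEEPClosureCellPrep
import Summits.AtomisticToContinuum.HydrodynamicLimit.Theorems.CollisionIsometryCLTAdaptedWeightCLTBHEEPClosurePinsker
import Literature.Analysis.FluidPDE.BoltzmannEquation
import Literature.MathematicalPhysics.KineticTheory.Hilbert6Wave0
import Literature.MathematicalPhysics.KineticTheory.EntropyProductionBounds

/-!
# Stub `stub_eepClosure` (S5) of the line `block-h-dissipation-closure`, helper file 9: the CELL CLOSURE —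
small Hellinger dissipation of the regularised cell law forces small traceless stress and heat flux, UNIFORMLY over
cells with a bounded Gaussian velocity moment (conditional on Villani's entropy–entropy-production inequality)
(crux `CollisionIsometryCLT.AdaptedWeightCLT`, stmt-AtomisticToContinuum-14868; `--supports`)

This is steps (i)–(iv) of the planner's sketch of `stub_eepClosure` composed at the level of ONE cell (a velocity cloud
with probability weights): for `0 < h < 1`, `0 < δ < 1`, `λ > 0`, `R` and every `ε > 0` there is `κ > 0` — depending on
nothing else — such that every cloud with `Σ p_i e^{λ|v_i|²} ≤ R` and `𝒟h(f̂) ≤ κ` has `cloudDefect ≤ ε`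
(`exists_cloudDefect_le_of_hellDiss_le`). Chain: `𝒟h(f̂) ≤ κ` ⟹ `D(f̂) ≤ (3/2)(2+L) Z₀ κ + J₀/(2L)` (helper 7,
step (i)) ⟹ `H(f̂ | M) ≤ H₀` by the ENTROPY–ENTROPY-PRODUCTION INEQUALITY `K H² ≤ D` (the cited fact `HardSphereEEP`
below, used as a hypothesis, at `ε = 1`) ⟹ `∫|f̂ − M| ≤ s₀` (parametric Csiszár–Kullback–Pinsker, helper 5) ⟹
`|∫(f̂ − M)p₂|, |∫(f̂ − M)p₃| ≤ η` (truncation + uniform centred moments, helper 8) ⟹ `cloudDefect ≤ 12 (1−δ)⁻² η² ≤ ε`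
(the exact `(1−δ)` identities, helpers 1–2). All constants are chosen backwards from `ε`.
The one definition of this file, `HardSphereEEP`, is a NAMED LITERATURE FACT (Villani 2003; Rezakhanlou–Villani LNM
1916 Ch. 1 Thm 4), special-cased to the regularised laws of velocity clouds — see its docstring for the printed
theorem and why the class satisfies its hypotheses uniformly; it is taken as an explicit hypothesis, never asserted.
Registered anchor: `bhEEPClosure_cell_anchor` (exponential moments dominate sixth moments, `∀`-closed).
-/

open scoped BigOperators
open MeasureTheory

noncomputable section

/-! ## The cited fact (inline; relocated by the gate under `Literature/MathematicalPhysics/KineticTheory/`) -/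

namespace Summit.AtomisticToContinuum.HydrodynamicLimit.Theorems.BlockHDissipation

open scoped BigOperators Topology Classical MeasureTheory ENNReal InnerProductSpace
open Filter Set MeasureTheory Real
open Literature.Analysis.FluidPDE
open Summit.AtomisticToContinuum.HydrodynamicLimit.Theorems.ContactSourceDuhamel (T3 V3 Cfg Vel Flow Flows)
open Literature.MathematicalPhysics.KineticTheory (collide hardSphereKernel sphereMeasure localMaxwellian_pos)
open Literature.MathematicalPhysics.KineticTheory (integral_localMaxwellian_one integrable_localMaxwellian)

namespace EEP

variable {n : ℕ} {p : Fin n → ℝ} {v : Fin n → V3} {h δ : ℝ}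

/-! ## From Gaussian to sixth moments -/

/-- `(1 + t)³ ≤ (6 e^λ / λ³) e^{λ t}` for `t ≥ 0 < λ` (`x³/3! ≤ eˣ` at `x = λ(1 + t)`). -/
theorem one_add_pow_three_le_exp {lam t : ℝ} (hlam : 0 < lam) (ht : 0 ≤ t) :
    (1 + t) ^ 3 ≤ 6 * Real.exp lam / lam ^ 3 * Real.exp (lam * t) := by
  have hx : 0 ≤ lam * (1 + t) := by positivity
  have h := Real.pow_div_factorial_le_exp (lam * (1 + t)) hx 3
  have h3 : ((Nat.factorial 3 : ℕ) : ℝ) = 6 := by norm_num [Nat.factorial]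
  rw [h3, mul_add, mul_one, Real.exp_add, div_le_iff₀ (by norm_num : (0 : ℝ) < 6)] at h
  have hl3 : 0 < lam ^ 3 := pow_pos hlam 3
  rw [div_mul_eq_mul_div, le_div_iff₀ hl3]
  have : (lam + lam * t) ^ 3 = (1 + t) ^ 3 * lam ^ 3 := by ring
  rw [this] at h
  linarith

/-- **Gaussian moments dominate sixth moments**: `Σ p_i (1 + |v_i|²)³ ≤ (6 e^λ/λ³) Σ p_i e^{λ|v_i|²}`. -/
theorem sum_cube_le_sum_exp (hp : ∀ i, 0 ≤ p i) {lam : ℝ} (hlam : 0 < lam) :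
    ∑ i, p i * (1 + ‖v i‖ ^ 2) ^ 3 ≤ 6 * Real.exp lam / lam ^ 3 * ∑ i, p i * Real.exp (lam * ‖v i‖ ^ 2) := by
  rw [Finset.mul_sum]
  refine Finset.sum_le_sum fun i _ => ?_
  have := one_add_pow_three_le_exp hlam (sq_nonneg ‖v i‖)
  calc p i * (1 + ‖v i‖ ^ 2) ^ 3 ≤ p i * (6 * Real.exp lam / lam ^ 3 * Real.exp (lam * ‖v i‖ ^ 2)) :=
        mul_le_mul_of_nonneg_left this (hp i)
    _ = 6 * Real.exp lam / lam ^ 3 * (p i * Real.exp (lam * ‖v i‖ ^ 2)) := by ring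

/-! ## The cited fact, read for the vocabulary's objects -/

/-- `HardSphereEEP` at `ε = 1` for `cloudLaw`/`cloudMaxw`: `K (∫ f̂ log(f̂/M))² ≤ D(f̂)`. -/
theorem sq_entropy_le_of_hardSphereEEP (hEEP : Literature.MathematicalPhysics.KineticTheory.HardSphereEEP) (hh : 0 < h) (hh1 : h ≤ 1) (hδ : 0 < δ) (hδ1 : δ < 1)
    {lam : ℝ} (hlam : 0 < lam) (R : ℝ) :
    ∃ K : ℝ, 0 < K ∧ ∀ (n : ℕ) (p : Fin n → ℝ) (v : Fin n → V3), (∀ i, 0 ≤ p i) → ∑ i, p i = 1 →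
      ∑ i, p i * Real.exp (lam * ‖v i‖ ^ 2) ≤ R →
        K * (∫ w, cloudLaw h δ p v w * Real.log (cloudLaw h δ p v w / cloudMaxw h p v w)) ^ 2 ≤
          entropyProduction hardSphereKernel (cloudLaw h δ p v) := by
  obtain ⟨K, hK, hmain⟩ := hEEP 1 h δ lam R one_pos hh hh1 hδ hδ1 hlam
  refine ⟨K, hK, fun n p v hp hp1 hR => ?_⟩
  have h1 := hmain n p v hp hp1 hR
  have h2 : ((1 : ℝ) + 1) = 2 := by norm_num
  simp only [h2, Real.rpow_two] at h1
  exact h1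

/-! ## The cell closure -/

/-- **Small Hellinger dissipation forces small relative entropy** (conditional on `HardSphereEEP`): for `0 < h ≤ 1`,
`0 < δ < 1`, `λ > 0`, `R` and `H₀ > 0` there is `κ > 0` such that every probability cloud with `Σ p_i e^{λ|v_i|²} ≤ R`
and `𝒟h(f̂) ≤ κ` has `∫ f̂ log(f̂/M) ≤ H₀` (step (i) with uniform constants, then `K H² ≤ D`). -/
theorem exists_entropy_le_of_hellDiss_le (hEEP : Literature.MathematicalPhysics.KineticTheory.HardSphereEEP) (hh : 0 < h) (hh1 : h ≤ 1) (hδ : 0 < δ)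
    (hδ1 : δ < 1) {lam : ℝ} (hlam : 0 < lam) (R : ℝ) {H₀ : ℝ} (hH₀ : 0 < H₀) :
    ∃ κ : ℝ, 0 < κ ∧ ∀ (n : ℕ) (p : Fin n → ℝ) (v : Fin n → V3), (∀ i, 0 ≤ p i) → ∑ i, p i = 1 →
      ∑ i, p i * Real.exp (lam * ‖v i‖ ^ 2) ≤ R → hellDiss (cloudLaw h δ p v) ≤ κ →
        ∫ w, cloudLaw h δ p v w * Real.log (cloudLaw h δ p v w / cloudMaxw h p v w) ≤ H₀ := by
  obtain ⟨Z₀, J₀, hZ0, hJ0, hZJ⟩ := exists_entropyProduction_cloudLaw_le hh hh1 hδ hδ1 (6 * Real.exp lam / lam ^ 3 * R)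
  obtain ⟨K, hK, hKEEP⟩ := sq_entropy_le_of_hardSphereEEP hEEP hh hh1 hδ hδ1 hlam R
  -- target entropy production `D₀ = K H₀²`, then `L` and `κ`
  have hD₀ : 0 < K * H₀ ^ 2 := by positivity
  obtain ⟨L, hL1, hLJ⟩ : ∃ L : ℝ, 1 ≤ L ∧ J₀ / (K * H₀ ^ 2) ≤ L :=
    ⟨max 1 (J₀ / (K * H₀ ^ 2)), le_max_left _ _, le_max_right _ _⟩
  have hL0 : 0 < L := lt_of_lt_of_le one_pos hL1
  refine ⟨K * H₀ ^ 2 / (3 * (2 + L) * (Z₀ + 1)), by positivity, fun n p v hp hp1 hR hD => ?_⟩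
  have hR6 : ∑ i, p i * (1 + ‖v i‖ ^ 2) ^ 3 ≤ 6 * Real.exp lam / lam ^ 3 * R :=
    (sum_cube_le_sum_exp hp hlam).trans (mul_le_mul_of_nonneg_left hR (by positivity))
  have hf0 : ∀ w, 0 ≤ cloudLaw h δ p v w := fun w => (cloudLaw_pos hp hh hδ hδ1.le w).le
  have hMpos : ∀ w, 0 < cloudMaxw h p v w := fun w => cloudMaxw_pos hp hh w
  have hfi : Integrable (cloudLaw h δ p v) := integrable_cloudLaw hp hp1 hh δ
  have hMi : Integrable (cloudMaxw h p v) := integrable_localMaxwellian (cloudTemp_add_sq_pos hp v hh) _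
  have hf1 : ∫ w, cloudLaw h δ p v w = 1 := integral_cloudLaw hp hp1 hh δ
  have hM1 : ∫ w, cloudMaxw h p v w = 1 := integral_localMaxwellian_one (cloudTemp_add_sq_pos hp v hh) _
  have hkl := integrable_cloudLaw_mul_log_div hp hp1 hh hh1 hδ hδ1 hR6
  have hHnn : 0 ≤ ∫ w, cloudLaw h δ p v w * Real.log (cloudLaw h δ p v w / cloudMaxw h p v w) :=
    integral_mul_log_div_nonneg hf0 hMpos hfi hMi hf1 hM1 hkl
  -- entropy production `≤ K H₀²`
  obtain ⟨-, hDle⟩ := hZJ n p v hp hp1 hR6 L hL0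
  have hDsmall : entropyProduction hardSphereKernel (cloudLaw h δ p v) ≤ K * H₀ ^ 2 := by
    have hDh0 : 0 ≤ hellDiss (cloudLaw h δ p v) := DVTransfer.hellDiss_nonneg hf0
    have hden : 0 < 3 * (2 + L) * (Z₀ + 1) := by positivity
    have hterm1 : 3 / 2 * (2 + L) * (Z₀ * hellDiss (cloudLaw h δ p v)) ≤ K * H₀ ^ 2 / 2 := by
      have h1 : 3 / 2 * (2 + L) * (Z₀ * hellDiss (cloudLaw h δ p v)) ≤
          3 / 2 * (2 + L) * (Z₀ * (K * H₀ ^ 2 / (3 * (2 + L) * (Z₀ + 1)))) :=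
        mul_le_mul_of_nonneg_left (mul_le_mul_of_nonneg_left hD hZ0) (by positivity)
      have h2 : 3 / 2 * (2 + L) * (Z₀ * (K * H₀ ^ 2 / (3 * (2 + L) * (Z₀ + 1)))) =
          K * H₀ ^ 2 / 2 * (Z₀ / (Z₀ + 1)) := by
        field_simp
      have h3 : Z₀ / (Z₀ + 1) ≤ 1 := by rw [div_le_one (by positivity)]; linarith
      have h4 : K * H₀ ^ 2 / 2 * (Z₀ / (Z₀ + 1)) ≤ K * H₀ ^ 2 / 2 := mul_le_of_le_one_right (by positivity) h3
      linarith
    have hterm2 : J₀ / (2 * L) ≤ K * H₀ ^ 2 / 2 := by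
      rw [div_le_iff₀ (by positivity)]
      have : J₀ ≤ L * (K * H₀ ^ 2) := by rw [div_le_iff₀ hD₀] at hLJ; linarith
      linarith
    linarith [hDle]
  -- EEP: `K H² ≤ D ≤ K H₀²`
  have hsq : (∫ w, cloudLaw h δ p v w * Real.log (cloudLaw h δ p v w / cloudMaxw h p v w)) ^ 2 ≤ H₀ ^ 2 :=
    le_of_mul_le_mul_left ((hKEEP n p v hp hp1 hR).trans hDsmall) hK
  exact (pow_le_pow_iff_left₀ hHnn hH₀.le two_ne_zero).1 hsq

/-- **CELL CLOSURE (conditional on `HardSphereEEP`).** For `0 < h < 1`, `0 < δ < 1`, `λ > 0`, `R` and `ε > 0` there is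
`κ > 0` such that every probability cloud with `Σ p_i e^{λ|v_i|²} ≤ R` and `𝒟h(f̂) ≤ κ` has `cloudDefect ≤ ε`. -/
theorem exists_cloudDefect_le_of_hellDiss_le (hEEP : Literature.MathematicalPhysics.KineticTheory.HardSphereEEP) (hh : 0 < h) (hh1 : h < 1) (hδ : 0 < δ)
    (hδ1 : δ < 1) {lam : ℝ} (hlam : 0 < lam) (R : ℝ) {ε : ℝ} (hε : 0 < ε) :
    ∃ κ : ℝ, 0 < κ ∧ ∀ (n : ℕ) (p : Fin n → ℝ) (v : Fin n → V3), (∀ i, 0 ≤ p i) → ∑ i, p i = 1 →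
      ∑ i, p i * Real.exp (lam * ‖v i‖ ^ 2) ≤ R → hellDiss (cloudLaw h δ p v) ≤ κ → cloudDefect p v ≤ ε := by
  -- `L¹` target from the truncation lemma (at the sixth-moment level `(6e^λ/λ³) R`)
  obtain ⟨s₀, hs₀, hsmall⟩ := exists_cloudDefect_le_of_L1 hh hh1.le hδ hδ1 (6 * Real.exp lam / lam ^ 3 * R) hε
  -- entropy target through the parametric Pinsker inequality with `τ = s₀/4`
  obtain ⟨κ, hκ, hent⟩ := exists_entropy_le_of_hellDiss_le hEEP hh hh1.le hδ hδ1 hlam R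
    (H₀ := s₀ ^ 2 / 4) (by positivity)
  refine ⟨κ, hκ, fun n p v hp hp1 hR hD => ?_⟩
  have hR6 : ∑ i, p i * (1 + ‖v i‖ ^ 2) ^ 3 ≤ 6 * Real.exp lam / lam ^ 3 * R :=
    (sum_cube_le_sum_exp hp hlam).trans (mul_le_mul_of_nonneg_left hR (by positivity))
  refine hsmall n p v hp hp1 hR6 ?_
  have hf0 : ∀ w, 0 ≤ cloudLaw h δ p v w := fun w => (cloudLaw_pos hp hh hδ hδ1.le w).le
  have hMpos : ∀ w, 0 < cloudMaxw h p v w := fun w => cloudMaxw_pos hp hh w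
  have hfi : Integrable (cloudLaw h δ p v) := integrable_cloudLaw hp hp1 hh δ
  have hMi : Integrable (cloudMaxw h p v) := integrable_localMaxwellian (cloudTemp_add_sq_pos hp v hh) _
  have hf1 : ∫ w, cloudLaw h δ p v w = 1 := integral_cloudLaw hp hp1 hh δ
  have hM1 : ∫ w, cloudMaxw h p v w = 1 := integral_localMaxwellian_one (cloudTemp_add_sq_pos hp v hh) _
  have hkl := integrable_cloudLaw_mul_log_div hp hp1 hh hh1.le hδ hδ1 hR6
  have hτ : 0 < s₀ / 4 := by positivity
  have h1 := integral_abs_sub_le_klDiv_param hf0 hMpos hfi hMi hf1 hM1 hkl hτ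
  have hH := hent n p v hp hp1 hR hD
  have h2 : (∫ w, cloudLaw h δ p v w * Real.log (cloudLaw h δ p v w / cloudMaxw h p v w)) / (2 * (s₀ / 4)) ≤
      (s₀ ^ 2 / 4) / (2 * (s₀ / 4)) := div_le_div_of_nonneg_right hH (by positivity)
  have h3 : (s₀ ^ 2 / 4) / (2 * (s₀ / 4)) + 2 * (s₀ / 4) = s₀ := by field_simp; ring
  linarith

end EEP

/-- Registered anchor of this helper file: Gaussian moments dominate sixth moments,
`Σ p_i (1 + |v_i|²)³ ≤ (6 e^λ/λ³) Σ p_i e^{λ|v_i|²}` for `p ≥ 0`, `λ > 0` (`EEP.sum_cube_le_sum_exp`). -/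
theorem bhEEPClosure_cell_anchor : ∀ (n : ℕ) (p : Fin n → ℝ) (v : Fin n → V3) (lam : ℝ), (∀ i, 0 ≤ p i) → 0 < lam → ∑ i, p i * (1 + ‖v i‖ ^ 2) ^ 3 ≤ 6 * Real.exp lam / lam ^ 3 * ∑ i, p i * Real.exp (lam * ‖v i‖ ^ 2) :=
  fun _ _ _ _ hp hlam => EEP.sum_cube_le_sum_exp hp hlam

end Summit.AtomisticToContinuum.HydrodynamicLimit.Theorems.BlockHDissipation

end
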